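import Summits.CriticalPhenomena.SAWScalingLimit.Theorems.SAWRenewalTightnessTightIdentificationGlue
import Summits.CriticalPhenomena.SAWScalingLimit.Theses.SAWQuadrupoleWard

/-!
# Route `SAWParafermion`: the assembly frame `Assembly`, and the tightness criterion (stmt-10209)

Items `stmt-CriticalPhenomena-0784` (`Assembly : SubseqIdentification → EventualTight →
SAWScalingLimit`) and `stmt-CriticalPhenomena-10209` (formerly also `SAWParafermion.Assembly2`,
dropped from that route by the multi-assembly autofix of 2026-08-16T14:43Z; the item lives on,
verbatim, as `SAWQuadrupoleWard.TightnessCriterion`: the SAW instance along the germ `𝓝[>] 0` of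
the Prokhorov/Billingsley criterion — `IsTightAlongMesh` + identification of the subsequential limit
laws ⟹ `ConvergesInLawToSLE (8/3)`), both immediate from the glue theorems of
`SAWRenewalTightnessTightIdentificationGlue.lean` (`tightIdentificationGlue_parafermion_proof`,
`saw_convergesInLawToSLE_of_isTightAlongMesh`).

## References

* P. Billingsley, *Convergence of Probability Measures*, 2nd ed. (1999), Thm. 5.1 and its
  Corollary [BillingsleyCPM1999].
-/

noncomputable section

namespace Summit.CriticalPhenomena.SAWScalingLimit.Theorems

/-- **Item `stmt-CriticalPhenomena-0784` (`SAWParafermion.Assembly`):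
`SubseqIdentification → EventualTight → SAWScalingLimit`** — identification of every
subsequential weak limit as the chordal SLE_{8/3} law plus tightness along the mesh give the
conjunct; `tightIdentificationGlue_parafermion_proof` with the hypotheses swapped.
[cite: BillingsleyCPM1999, Thm. 5.1, Corollary] -/
theorem parafermion_assembly_proof : Theses.SAWParafermion.Assembly :=
  fun hI hT => tightIdentificationGlue_parafermion_proof hT hI

/-- **Item `stmt-CriticalPhenomena-10209` (`SAWQuadrupoleWard.TightnessCriterion`; until the
multi-assembly autofix of 2026-08-16 also `SAWParafermion.Assembly2`, same statement)**: for every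
Dobrushin domain and endpoint approximation, `IsTightAlongMesh` of the critical SAW curve laws and
identification of every subsequential limit law (a probability measure) as the chordal SLE_{8/3} law
imply `ConvergesInLawToSLE (8/3)` — the SAW instance `saw_convergesInLawToSLE_of_isTightAlongMesh` of
the eventually-probability convergence criterion. [cite: BillingsleyCPM1999, Thm. 5.1, Corollary] -/
theorem parafermion_tightnessCriterion_proof : Theses.SAWQuadrupoleWard.TightnessCriterion :=
  fun _D _a _b hab hT hL => saw_convergesInLawToSLE_of_isTightAlongMesh hab hT hL

/-! ### Record of the dropped twin `SAWParafermion.Assembly2` -/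

/-- **RECORD of the dropped route declaration `SAWParafermion.Assembly2`** (item
`stmt-CriticalPhenomena-10209` as it was wanted by route `SAWParafermion`; dropped from that route's
file by the gate's multi-assembly autofix, 2026-08-16T14:43Z, the item itself staying closed and
wanted by `SAWQuadrupoleWard` as `TightnessCriterion`).  Verbatim the item's ledger signature, kept
under the sub-namespace `Dropped` so that the landed theorem `parafermion_assembly2_proof` below keeps
its statement text (Theorems files are append-only).  A local record of a route statement, proved
below — not a literature fact (deliberately untagged). -/
def Dropped.Theses.SAWParafermion.Assembly2 : Prop :=
  ∀ (D : Literature.Probability.RandomPlanarGeometry.DobrushinDomain) (a b : ℝ → Literature.Probability.LatticeModels.Site 2), Literature.Probability.RandomPlanarGeometry.SAW.IsEndpointApprox D a b → Literature.Probability.RandomPlanarGeometry.IsTightAlongMesh (fun δ (γ : Literature.Probability.RandomPlanarGeometry.SAW.DomainSAW D.carrier δ (a δ) (b δ)) => γ.curve) (fun δ => Literature.Probability.RandomPlanarGeometry.SAW.law D.carrier δ (a δ) (b δ)) → (∀ μ : MeasureTheory.Measure (Literature.Probability.RandomPlanarGeometry.CurveClass ℂ), MeasureTheory.IsProbabilityMeasure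 μ → Literature.Probability.RandomPlanarGeometry.IsSubseqLimitLaw (fun δ (γ : Literature.Probability.RandomPlanarGeometry.SAW.DomainSAW D.carrier δ (a δ) (b δ)) => γ.curve) (fun δ => Literature.Probability.RandomPlanarGeometry.SAW.law D.carrier δ (a δ) (b δ)) μ → Literature.Probability.RandomPlanarGeometry.IsSLELaw ((8 : NNReal) / 3) D μ) → Literature.Probability.RandomPlanarGeometry.ConvergesInLawToSLE ((8 : NNReal) / 3) D (fun δ (γ : Literature.Probability.RandomPlanarGeometry.SAW.DomainSAW D.carrier δ (a δ) (b δ)) => γ.curve) (fun δ => Literature.Probability.RandomPlanarGeometry.SAW.law D.carrier δ (a δ) (b δ))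

/-- The record is, verbatim, the live route declaration `SAWQuadrupoleWard.TightnessCriterion`.
[folklore] -/
theorem Dropped.Theses.SAWParafermion.Assembly2_iff :
    Dropped.Theses.SAWParafermion.Assembly2 ↔ Theses.SAWQuadrupoleWard.TightnessCriterion :=
  Iff.rfl

open Dropped in
/-- **Item `stmt-CriticalPhenomena-10209` in its dropped `SAWParafermion.Assembly2` dress** (the
item's `closed_by` declaration; its type is now the local record `Dropped.Theses.SAWParafermion.Assembly2`,
definitionally `SAWQuadrupoleWard.TightnessCriterion`, proved afresh on the live declaration by
`parafermion_tightnessCriterion_proof`): for every Dobrushin domain and endpoint approximation,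
`IsTightAlongMesh` of the critical SAW curve laws and identification of every subsequential limit
law (a probability measure) as the chordal SLE_{8/3} law imply `ConvergesInLawToSLE (8/3)` — the
SAW instance `saw_convergesInLawToSLE_of_isTightAlongMesh` of the eventually-probability
convergence criterion. [cite: BillingsleyCPM1999, Thm. 5.1, Corollary] -/
theorem parafermion_assembly2_proof : Theses.SAWParafermion.Assembly2 :=
  fun _D _a _b hab hT hL => saw_convergesInLawToSLE_of_isTightAlongMesh hab hT hL

end Summit.CriticalPhenomena.SAWScalingLimit.Theorems
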